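import Literature.NumberTheory.LFunctions.HeilbronnReflection
import HarnessLib

/-!
# Heilbronn–Stark: a simple zero of `ζ_N` is carried by a real character of degree one; quadratic subfields

Topic `Literature/NumberTheory/LFunctions`, grouping namespace
`Literature.NumberTheory.LFunctions.Heilbronn` (sequel to `HeilbronnReflection.lean`).
Everything in this file is PROVED (theorems only).

**Stark's theorem on simple zeros** ([Stark1974, Thm. 3]; [MurtyMurty1997, Ch. 2, Cor. 6.2]: a
zero of an Artin `L`-function of the Galois extension `N/F` in Stark's region "exists only if `χ`
is a real Abelian character of a quadratic subfield"), in the Dedekind-zeta form over the tree's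
finite Galois quotients `q : Γ_F → G` (`N = F̄^{ker q}`, fixed fields `F_H = F̄^{q⁻¹(H)}`):

* `isIrrChar_coe_monoidHom`, `exists_monoidHom_of_isCharacter_apply_one` — characters of degree one;
* `conj_heilbronnChar` — **`θ_G` is real-valued at a real point** (from the reflection
  `n(G, Ind_C^G ψ⁻¹) = n(G, Ind_C^G ψ)` on cyclic `C` and the expansion of `θ_G|_C`);
* `heilbronnChar_eq_zero_or_eq_coe` — **structure theorem**: at a real `s₀ ≠ 1` with
  `ord_{s₀} ζ_N ≤ 1`, either `θ_G = 0` or `θ_G = χ₁` for a `{±1}`-valued homomorphism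
  `χ₁ : G → ℂˣ` ([MurtyMurty1997, Prop. 5.2]: `Σ n(G,χ)² ≤ 1` and `Σ χ(1) n(G,χ) = 1`);
* `dedekindZetaCont_quotientFixedField_eq_zero_iff` — then **`ζ_{F_H}(s₀) = 0 ↔ H ≤ ker χ₁`**;
  `dedekindZetaCont_quotientFixedField_ne_zero_of_eq_zero` — if `θ_G = 0` no `ζ_{F_H}` vanishes;
* `exists_index_two_of_dedekindZetaCont_eq_zero` — **Stark's theorem**: if moreover
  `ζ_{F_G}(s₀) ≠ 0` (the base field) and `ζ_{F_H}(s₀) = 0`, then `H ≤ H₂` for a subgroup `H₂` of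
  index `2`, i.e. `F_H` contains a quadratic extension of `F` inside `N`.

## References

* H. M. Stark, *Some effective cases of the Brauer–Siegel theorem*, Invent. Math. 23 (1974)
  135–152, Thm. 3. [Stark1974]
* M. R. Murty, V. K. Murty, *Non-vanishing of `L`-functions and applications*, Birkhäuser 1997,
  Ch. 2 §5 Prop. 5.2, §6 Cor. 6.2. [MurtyMurty1997]
-/

noncomputable section

open Filter Complex Set
open scoped Topology

namespace Literature.NumberTheory.LFunctions

namespace Heilbronn

open Literature.NumberTheory.GaloisRepresentations Literature.NumberTheory.Automorphic

universe u


section Structure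

open scoped ComplexConjugate
open Literature.RepresentationTheory.FiniteGroups

variable {F : Type} [Field F] [NumberField F] {G : Type} [Group G] [Fintype G]
  {q : Field.absoluteGaloisGroup F →* G}

/-! ### Linear characters -/

omit [NumberField F] [Fintype G] in
/-- **A character of degree one `θ : H →* ℂˣ` is an irreducible character** (of the
one-dimensional representation `h ↦ θ(h) · id_ℂ`). [cite: SerreLinearRepresentations1977, §1.2] -/
theorem isIrrChar_coe_monoidHom {H : Type} [Group H] (θ : H →* ℂˣ) :
    IsIrrChar H (fun h => (θ h : ℂ)) := by
  refine ⟨ℂ, _, _, inferInstance,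
    (DistribMulAction.toModuleEnd ℂ ℂ).comp ((Units.coeHom ℂ).comp θ),
    isIrreducible_of_finrank_eq_one _ (Module.finrank_self ℂ), funext fun g => ?_⟩
  show LinearMap.trace ℂ ℂ (DistribMulAction.toModuleEnd ℂ ℂ ((θ g : ℂˣ) : ℂ)) = (θ g : ℂ)
  have : DistribMulAction.toModuleEnd ℂ ℂ ((θ g : ℂˣ) : ℂ) = ((θ g : ℂˣ) : ℂ) • LinearMap.id := by
    ext
    simp
  rw [this, map_smul, LinearMap.trace_id, Module.finrank_self, Nat.cast_one, smul_eq_mul, mul_one]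

omit [NumberField F] [Fintype G] in
/-- **A character with `χ(1) = 1` is a homomorphism `G → ℂˣ`** (a representation of dimension
one acts by scalars, Serre §1.2). [cite: SerreLinearRepresentations1977, §1.2] -/
theorem exists_monoidHom_of_isCharacter_apply_one [Finite G] {χ : G → ℂ} (hχ : IsCharacter G χ)
    (h1 : χ 1 = 1) : ∃ θ : G →* ℂˣ, ∀ g, χ g = θ g := by
  obtain ⟨V, _, _, _, ρ, rfl⟩ := hχ
  have hV : Module.finrank ℂ V = 1 := by
    have h := ρ.char_one
    rw [h1] at h
    exact_mod_cast h.symm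
  have key : ∀ g, ρ g = ρ.character g • LinearMap.id := fun g =>
    End.eq_trace_smul_id_of_finrank_eq_one hV (ρ g)
  obtain ⟨v, hv, -⟩ := finrank_eq_one_iff'.mp hV
  have hmul : ∀ x y, ρ.character (x * y) = ρ.character x * ρ.character y := by
    intro x y
    have := LinearMap.congr_fun (_root_.map_mul ρ x y) v
    rw [Module.End.mul_apply, key (x * y), key x, key y] at this
    simp only [LinearMap.smul_apply, LinearMap.id_apply, smul_smul] at this
    exact smul_left_injective ℂ hv this
  exact ⟨MonoidHom.toHomUnits ⟨⟨ρ.character, h1⟩, hmul⟩, fun g => rfl⟩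

omit [NumberField F] [Fintype G] in
/-- A real complex number of norm one is `±1`. [folklore] -/
theorem eq_one_or_eq_neg_one_of_conj_eq {z : ℂ} (hreal : conj z = z) (hnorm : ‖z‖ = 1) :
    z = 1 ∨ z = -1 := by
  have hz : (z.re : ℂ) = z := Complex.conj_eq_iff_re.mp hreal
  have habs : |z.re| = 1 := by
    rw [← hz, Complex.norm_real, Real.norm_eq_abs] at hnorm; exact hnorm
  rcases abs_eq (zero_le_one) |>.mp habs with h | h
  · left; rw [← hz, h]; simp
  · right; rw [← hz, h]; simp

/-! ### Realness of `θ_G` at a real point -/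

omit [NumberField F] [Fintype G] in
/-- The conjugate of an irreducible character of a commutative finite group is irreducible (it is
the character of degree one `ψ⁻¹`). [cite: SerreLinearRepresentations1977, §3.1] -/
theorem _root_.Literature.RepresentationTheory.FiniteGroups.IsIrrChar.conj_comm {C : Type} [Group C]
    [Finite C] [IsMulCommutative C] {ψ : C → ℂ} (hψ : IsIrrChar C ψ) :
    IsIrrChar C (fun c => conj (ψ c)) := by
  have h : (fun c => conj (ψ c)) = fun c => ((hψ.toHomUnits)⁻¹ c : ℂ) := by
    funext c
    rw [← hψ.coe_toHomUnits_apply c, MonoidHom.conj_coe_apply_eq_inv]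
  rw [h]
  exact isIrrChar_coe_monoidHom _

omit [NumberField F] [Fintype G] in
/-- The homomorphism of the conjugate character is the inverse homomorphism. [folklore] -/
theorem _root_.Literature.RepresentationTheory.FiniteGroups.IsIrrChar.toHomUnits_conj_comm {C : Type}
    [Group C] [Finite C] [IsMulCommutative C] {ψ : C → ℂ} (hψ : IsIrrChar C ψ) :
    hψ.conj_comm.toHomUnits = (hψ.toHomUnits)⁻¹ := by
  refine MonoidHom.ext fun c => Units.ext ?_
  rw [IsIrrChar.coe_toHomUnits_apply, ← MonoidHom.conj_coe_apply_eq_inv, IsIrrChar.coe_toHomUnits_apply]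

/-- **Heilbronn's character is real-valued at a real point `s₀`** ([Stark1974, §3]; here from
`n(G, Ind_C^G ψ⁻¹) = n(G, Ind_C^G ψ)` on cyclic `C = ⟨g⟩`, `artinOrder_indClassFun_inv`, and the
expansion `θ_G(g) = Σ_ψ n(G, Ind_C^G ψ) ψ(g)`). [cite: Stark1974, §3] -/
theorem conj_heilbronnChar (hq : IsArtinQuotient q) {s₀ : ℂ} (hreal : conj s₀ = s₀) (g : G) :
    conj (heilbronnChar q s₀ g) = heilbronnChar q s₀ g := by
  classical
  set C : Subgroup G := Subgroup.zpowers g with hC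
  set R : C → ℂ := fun c => heilbronnChar q s₀ c with hR
  have hRcl : IsClassFun R := fun c t => by
    rw [hR]; simp only; rw [IsMulCommutative.is_comm.comm t c, mul_inv_cancel_right]
  have hexp := hRcl.eq_sum_classInner_smul
  have hcoef : ∀ (ψ : C → ℂ) (hψ' : IsIrrChar C ψ),
      classInner R ψ = artinOrder s₀ (indClassFun C (fun c => (hψ'.toHomUnits c : ℂ)) ∘ q) := by
    intro ψ hψ'
    rw [classInner_comm]
    exact classInner_restrict_heilbronnChar hq s₀ C hψ'.toHomUnits
  have hg : (g : G) ∈ C := Subgroup.mem_zpowers g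
  set T := (irrChars_finite_holds C).toFinset with hT
  have hmemT : ∀ {ψ : C → ℂ}, ψ ∈ T ↔ IsIrrChar C ψ := fun {ψ} => (irrChars_finite_holds C).mem_toFinset
  have hRg : heilbronnChar q s₀ g = ∑ ψ ∈ T, classInner R ψ * ψ ⟨g, hg⟩ := by
    show R ⟨g, hg⟩ = _
    conv_lhs => rw [hexp]
    simp only [Finset.sum_apply, Pi.smul_apply, smul_eq_mul]
  -- coefficients are integers and invariant under `ψ ↦ conj ∘ ψ`
  have hcoefZ : ∀ ψ ∈ T, conj (classInner R ψ) = classInner R ψ := fun ψ hψ => by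
    rw [hcoef ψ (hmemT.mp hψ), map_intCast]
  have hinv : ∀ (ψ : C → ℂ) (hψ : IsIrrChar C ψ), classInner R (fun c => conj (ψ c)) = classInner R ψ := by
    intro ψ hψ
    rw [hcoef _ hψ.conj_comm, hcoef _ hψ, hψ.toHomUnits_conj_comm]
    exact_mod_cast artinOrder_indClassFun_inv hq hreal C hψ.toHomUnits
  rw [hRg, map_sum]
  simp only [map_mul]
  rw [Finset.sum_congr rfl fun ψ hψ => by rw [hcoefZ ψ hψ]]
  -- reindex by the involution `ψ ↦ conj ∘ ψ`
  refine Finset.sum_nbij' (fun ψ => fun c => conj (ψ c)) (fun ψ => fun c => conj (ψ c))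
    (fun ψ hψ => hmemT.mpr (hmemT.mp hψ).conj_comm) (fun ψ hψ => hmemT.mpr (hmemT.mp hψ).conj_comm)
    (fun ψ _ => funext fun c => Complex.conj_conj _) (fun ψ _ => funext fun c => Complex.conj_conj _)
    (fun ψ hψ => ?_)
  rw [hinv ψ (hmemT.mp hψ)]

/-! ### A simple zero (or no zero) of `ζ_N`: `θ_G` vanishes or is a real linear character -/

/-- **Heilbronn–Stark structure theorem.** At a real point `s₀ ≠ 1` where `ζ_N` (`N` the field
of `G`) vanishes to order at most `1` (`n(G, r_G) ≤ 1`), Heilbronn's character is either `0` or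
a REAL character of degree one `χ₁` of `G` ([MurtyMurty1997, Ch. 2 Prop. 5.2]:
`Σ_χ n(G,χ)² ≤ n(G, reg)²`, so with `n(G, reg) = 1` exactly one `n(G,χ) = 1` with `χ(1) = 1`;
[Stark1974, §3, Thm. 3]). [cite: MurtyMurty1997, Ch. 2 Prop. 5.2] [cite: Stark1974, Thm. 3] -/
theorem heilbronnChar_eq_zero_or_eq_coe (hq : IsArtinQuotient q) {s₀ : ℂ} (hs₀ : s₀ ≠ 1)
    (hreal : conj s₀ = s₀)
    (hle : artinOrder s₀ ((Representation.leftRegular ℂ G).character ∘ q) ≤ 1) :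
    heilbronnChar q s₀ = 0 ∨
      ∃ χ₁ : G →* ℂˣ, (heilbronnChar q s₀ = fun g => (χ₁ g : ℂ)) ∧
        ∀ g, (χ₁ g : ℂ) = 1 ∨ (χ₁ g : ℂ) = -1 := by
  classical
  set θ := heilbronnChar q s₀ with hθ
  set T := (irrChars_finite_holds G).toFinset with hT
  set n : (G → ℂ) → ℤ := fun χ => artinOrder s₀ (χ ∘ q) with hn
  set e : ℤ := artinOrder s₀ ((Representation.leftRegular ℂ G).character ∘ q) with he
  have hmemT : ∀ {χ : G → ℂ}, χ ∈ T ↔ IsIrrChar G χ := fun {χ} => (irrChars_finite_holds G).mem_toFinset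
  have hθ1 : θ 1 = (e : ℂ) := heilbronnChar_one hq s₀
  have hre : (θ 1).re = e := by rw [hθ1]; simp
  have he0 : 0 ≤ e := by
    have h := norm_heilbronnChar_le hq hs₀ (1 : G)
    rw [hre] at h
    exact_mod_cast (norm_nonneg _).trans h
  have hsq : (∑ χ ∈ T, n χ ^ 2 : ℤ) ≤ e ^ 2 := by
    have h := sum_sq_artinOrder_le hq hs₀ (G := G) (q := q)
    rw [hre] at h
    exact_mod_cast h
  have hθsum : θ = ∑ χ ∈ T, (n χ : ℂ) • χ := rfl
  have hterm_le : ∀ χ ∈ T, n χ ^ 2 ≤ 1 := fun χ hχ =>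
    ((Finset.single_le_sum (fun χ' _ => sq_nonneg (n χ')) hχ).trans hsq).trans (by nlinarith)
  rcases (show e = 0 ∨ e = 1 by omega) with he' | he'
  · -- `e = 0`: all coefficients vanish
    left
    have hzero : ∀ χ ∈ T, n χ = 0 := fun χ hχ => by
      have h := (Finset.single_le_sum (fun χ' _ => sq_nonneg (n χ')) hχ).trans hsq
      rw [he'] at h
      exact pow_eq_zero_iff two_ne_zero |>.mp (le_antisymm (by simpa using h) (sq_nonneg _))
    rw [hθsum]
    exact Finset.sum_eq_zero fun χ hχ => by rw [hzero χ hχ]; simp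
  · -- `e = 1`: exactly one coefficient, equal to `1`, at a character of degree `1`
    right
    have hS : ∀ χ ∈ T, ∀ χ' ∈ T, n χ ≠ 0 → n χ' ≠ 0 → χ = χ' := by
      intro χ hχ χ' hχ' h0 h0'
      by_contra hne
      have h2 : n χ ^ 2 + n χ' ^ 2 ≤ ∑ ψ ∈ T, n ψ ^ 2 := by
        rw [← Finset.sum_pair (f := fun ψ => n ψ ^ 2) hne]
        exact Finset.sum_le_sum_of_subset_of_nonneg
          (by intro x hx; simp only [Finset.mem_insert, Finset.mem_singleton] at hx
              rcases hx with rfl | rfl <;> assumption)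
          (fun ψ _ _ => sq_nonneg (n ψ))
      have h1 : 1 ≤ n χ ^ 2 := by nlinarith [sq_pos_of_ne_zero h0]
      have h1' : 1 ≤ n χ' ^ 2 := by nlinarith [sq_pos_of_ne_zero h0']
      rw [he'] at hsq
      linarith
    -- some coefficient is non-zero since `θ 1 = 1`
    have hex : ∃ χ₁ ∈ T, n χ₁ ≠ 0 := by
      by_contra hall
      push Not at hall
      have : θ 1 = 0 := by
        rw [hθsum, Finset.sum_apply]
        exact Finset.sum_eq_zero fun χ hχ => by simp [hall χ hχ]
      rw [hθ1, he'] at this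
      simp at this
    obtain ⟨χ₁, hχ₁T, hn₁⟩ := hex
    have hχ₁ : IsIrrChar G χ₁ := hmemT.mp hχ₁T
    have hθχ : θ = (n χ₁ : ℂ) • χ₁ := by
      rw [hθsum]
      exact Finset.sum_eq_single χ₁ (fun χ hχ hne => by
        have : n χ = 0 := by
          by_contra h0
          exact hne (hS χ hχ χ₁ hχ₁T h0 hn₁)
        simp [this]) (fun h => absurd hχ₁T h)
    obtain ⟨d, hd, hd1⟩ := hχ₁.exists_apply_one_eq_natCast
    have hnd : (n χ₁ : ℂ) * d = 1 := by
      have := congrFun hθχ 1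
      rw [Pi.smul_apply, smul_eq_mul, hd1, hθ1, he'] at this
      exact_mod_cast this.symm
    have hnd' : n χ₁ * d = 1 := by exact_mod_cast hnd
    have hn1 : n χ₁ = 1 := by
      have hb := hterm_le χ₁ hχ₁T
      have hdpos : (0 : ℤ) < d := by exact_mod_cast hd
      nlinarith
    have hd1' : d = 1 := by
      rw [hn1, one_mul] at hnd'
      exact_mod_cast hnd'
    have hθeq : θ = χ₁ := by rw [hθχ, hn1]; simp
    have hχ₁one : χ₁ 1 = 1 := by rw [hd1, hd1']; simp
    obtain ⟨θ₁, hθ₁⟩ := exists_monoidHom_of_isCharacter_apply_one hχ₁.isCharacter hχ₁one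
    refine ⟨θ₁, ?_, fun g => ?_⟩
    · rw [hθeq]; funext g; exact hθ₁ g
    · have hrealg : conj ((θ₁ g : ℂˣ) : ℂ) = θ₁ g := by
        rw [← hθ₁ g, ← hθeq]
        exact conj_heilbronnChar hq hreal g
      have hnorm : ‖((θ₁ g : ℂˣ) : ℂ)‖ = 1 := by
        rw [← hθ₁ g]
        have hfin : IsOfFinOrder g := isOfFinOrder_of_finite g
        obtain ⟨m, hm, hgm⟩ := hfin.exists_pow_eq_one
        have h : χ₁ g ^ m = 1 := by
          rw [hθ₁ g, ← Units.val_pow_eq_pow_val, ← map_pow, hgm, map_one, Units.val_one]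
        exact Complex.norm_eq_one_of_pow_eq_one h hm.ne'
      exact eq_one_or_eq_neg_one_of_conj_eq hrealg hnorm

/-! ### The subfield criterion -/

/-- `n(G, Ind_H^G 1) = ⟨1_H, θ_G|_H⟩_H` as a complex number. [cite: MurtyMurty1997, Ch. 2 §5 Prop. 5.1] -/
theorem artinOrder_indClassFun_one_eq_classInner (hq : IsArtinQuotient q) (s₀ : ℂ) (H : Subgroup G)
    [Fintype H] :
    (artinOrder s₀ (indClassFun H (fun _ => (1 : ℂ)) ∘ q) : ℂ) =
      classInner (fun _ : H => (1 : ℂ)) (fun h : H => heilbronnChar q s₀ h) := by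
  have h := classInner_restrict_heilbronnChar hq s₀ H 1
  rw [indClassFun_one_coe] at h
  rw [← h]
  simp only [MonoidHom.one_apply, Units.val_one]

/-- **`ζ_{F_H}(s₀) = 0 ↔ H ≤ ker χ₁`** when Heilbronn's character is the character of degree one
`χ₁` (orthonormality on `H`: `⟨1_H, χ₁|_H⟩_H = [χ₁|_H = 1]`). [cite: Stark1974, Thm. 3] -/
theorem dedekindZetaCont_quotientFixedField_eq_zero_iff (hq : IsArtinQuotient q) {s₀ : ℂ}
    (hs₀ : s₀ ≠ 1) {χ₁ : G →* ℂˣ} (hθ : heilbronnChar q s₀ = fun g => (χ₁ g : ℂ))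
    (H : Subgroup G) [NumberField (quotientFixedField q H)] :
    dedekindZetaCont (quotientFixedField q H) s₀ = 0 ↔ H ≤ χ₁.ker := by
  classical
  rw [← (artinOrder_indClassFun_one_pos_iff hq hs₀ H).2]
  have hval : (artinOrder s₀ (indClassFun H (fun _ => (1 : ℂ)) ∘ q) : ℂ) =
      if (fun _ : H => (1 : ℂ)) = (fun h : H => (χ₁ h : ℂ)) then 1 else 0 := by
    rw [artinOrder_indClassFun_one_eq_classInner hq s₀ H, hθ]
    have h1 : IsIrrChar H (fun h : H => ((1 : H →* ℂˣ) h : ℂ)) := isIrrChar_coe_monoidHom 1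
    have h2 : IsIrrChar H (fun h : H => ((χ₁.comp H.subtype) h : ℂ)) :=
      isIrrChar_coe_monoidHom (χ₁.comp H.subtype)
    simp only [MonoidHom.one_apply, Units.val_one, MonoidHom.coe_comp, Subgroup.coe_subtype,
      Function.comp_apply] at h1 h2
    exact h1.classInner_eq h2
  have hker : ((fun _ : H => (1 : ℂ)) = fun h : H => (χ₁ h : ℂ)) ↔ H ≤ χ₁.ker := by
    constructor
    · intro h x hx
      have := congrFun h ⟨x, hx⟩
      rw [MonoidHom.mem_ker]
      exact Units.ext (by simpa using this.symm)
    · intro h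
      funext x
      have hx := h x.2
      rw [MonoidHom.mem_ker] at hx
      simp [hx]
  rw [← hker]
  by_cases hc : (fun _ : H => (1 : ℂ)) = fun h : H => (χ₁ h : ℂ)
  · rw [if_pos hc] at hval
    have h1 : artinOrder s₀ (indClassFun H (fun _ => (1 : ℂ)) ∘ q) = 1 := by exact_mod_cast hval
    exact ⟨fun _ => hc, fun _ => by rw [h1]; exact one_pos⟩
  · rw [if_neg hc] at hval
    have h0 : artinOrder s₀ (indClassFun H (fun _ => (1 : ℂ)) ∘ q) = 0 := by exact_mod_cast hval
    rw [h0]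
    exact ⟨fun h => absurd h (lt_irrefl 0), fun h => absurd h hc⟩

/-- When Heilbronn's character vanishes, no `ζ_{F_H}` vanishes at `s₀`. [cite: Stark1974, Thm. 3] -/
theorem dedekindZetaCont_quotientFixedField_ne_zero_of_eq_zero (hq : IsArtinQuotient q) {s₀ : ℂ}
    (hs₀ : s₀ ≠ 1) (hθ : heilbronnChar q s₀ = 0) (H : Subgroup G)
    [NumberField (quotientFixedField q H)] :
    dedekindZetaCont (quotientFixedField q H) s₀ ≠ 0 := by
  classical
  rw [Ne, ← (artinOrder_indClassFun_one_pos_iff hq hs₀ H).2, not_lt]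
  have h := artinOrder_indClassFun_one_eq_classInner hq s₀ H
  rw [hθ] at h
  simp only [Pi.zero_apply] at h
  rw [show (fun _ : H => (0 : ℂ)) = 0 from rfl, classInner_comm, classInner_zero_left] at h
  have : artinOrder s₀ (indClassFun H (fun _ => (1 : ℂ)) ∘ q) = 0 := by exact_mod_cast h
  rw [this]

omit [NumberField F] [Fintype G] in
/-- A non-trivial `{±1}`-valued homomorphism has kernel of index `2`. [folklore] -/
theorem index_ker_eq_two_of_sign {χ₁ : G →* ℂˣ} (hpm : ∀ g, (χ₁ g : ℂ) = 1 ∨ (χ₁ g : ℂ) = -1)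
    (hne : χ₁ ≠ 1) : χ₁.ker.index = 2 := by
  obtain ⟨a, ha⟩ : ∃ a, χ₁ a ≠ 1 := by
    by_contra hall
    push Not at hall
    exact hne (MonoidHom.ext hall)
  have ha' : (χ₁ a : ℂ) = -1 := by
    rcases hpm a with h | h
    · exact absurd (Units.ext h) ha
    · exact h
  rw [Subgroup.index_eq_two_iff]
  refine ⟨a, fun b => ?_⟩
  simp only [MonoidHom.mem_ker, map_mul]
  rcases hpm b with hb | hb
  · have hb1 : χ₁ b = 1 := Units.ext hb
    rw [hb1, one_mul]
    exact Or.inr ⟨rfl, ha⟩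
  · have hb1 : χ₁ b ≠ 1 := fun h => by rw [h, Units.val_one] at hb; norm_num at hb
    have hba : χ₁ b * χ₁ a = 1 := Units.ext (by rw [Units.val_mul, hb, ha']; norm_num)
    exact Or.inl ⟨hba, hb1⟩

/-- **Stark's theorem on simple zeros, Dedekind-zeta form** ([Stark1974, Thm. 3]; [MurtyMurty1997,
Ch. 2 Cor. 6.2]). Let `q : Γ_F → G` exhibit the finite Galois extension `N/F` (`N = F̄^{ker q}`),
let `s₀ ≠ 1` be REAL with `ord_{s₀} ζ_N ≤ 1` (as `n(G, r_G) ≤ 1`) and `ζ_F(s₀) ≠ 0` (as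
`ζ_{F̄^{Γ_F}}(s₀) ≠ 0`). If `ζ_{F_H}(s₀) = 0` for the fixed field `F_H` of `H ≤ G`, then `H` is
contained in a subgroup of index `2` — i.e. `F_H` contains a quadratic extension of `F` inside `N`.
[cite: Stark1974, Thm. 3] [cite: MurtyMurty1997, Ch. 2 Cor. 6.2] -/
theorem exists_index_two_of_dedekindZetaCont_eq_zero (hq : IsArtinQuotient q) {s₀ : ℂ} (hs₀ : s₀ ≠ 1)
    (hreal : conj s₀ = s₀)
    (hle : artinOrder s₀ ((Representation.leftRegular ℂ G).character ∘ q) ≤ 1)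
    [NumberField (quotientFixedField q (⊤ : Subgroup G))]
    (htop : dedekindZetaCont (quotientFixedField q (⊤ : Subgroup G)) s₀ ≠ 0)
    (H : Subgroup G) [NumberField (quotientFixedField q H)]
    (hH : dedekindZetaCont (quotientFixedField q H) s₀ = 0) :
    ∃ H₂ : Subgroup G, H ≤ H₂ ∧ H₂.index = 2 := by
  rcases heilbronnChar_eq_zero_or_eq_coe hq hs₀ hreal hle with hθ | ⟨χ₁, hθ, hpm⟩
  · exact absurd hH (dedekindZetaCont_quotientFixedField_ne_zero_of_eq_zero hq hs₀ hθ H)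
  · have hHle : H ≤ χ₁.ker := (dedekindZetaCont_quotientFixedField_eq_zero_iff hq hs₀ hθ H).mp hH
    have hne : χ₁ ≠ 1 := by
      intro h1
      apply htop
      rw [dedekindZetaCont_quotientFixedField_eq_zero_iff hq hs₀ hθ ⊤, h1, MonoidHom.ker_one]
    exact ⟨χ₁.ker, hHle, index_ker_eq_two_of_sign hpm hne⟩

end Structure

end Heilbronn

end Literature.NumberTheory.LFunctions

end
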